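import Literature.Probability.Percolation.TriQuadStages
import Literature.Probability.Percolation.TriAnnulusArms
import HarnessLib

/-!
# The number of stages of the successive-lowest-crossings construction has an exponential tail

Topic `Literature/Probability/Percolation`; family `crit-perc`, statement **crit-perc.S16**
(`Literature.Probability.Percolation.triTheta_exponent`). Second step of the discrete rendering of
Nolin's separation lemma (EJP 13 (2008), §4.4, proof of Lemma 15 [arXiv 0711.4948: Lemma 14]):

> "First we note that there cannot be too many disjoint crossings in `U_N^{1,ext}`. Indeed, the
> probability of crossing this domain is less than some `1 - δ'` (by RSW): combined with the BK
> inequality, this implies that the probability of observing at least `h` crossings is less than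
> `(1-δ')^h`. We thus take `T` such that this quantity is less than `δ/4`. […] The process stops
> after `t` steps […] `P(t ≥ T) ≤ (1-δ')^T ≤ δ/4`."

For an abstract lattice quad `Q` and the iteration `Q.stages ω` of `TriQuadStages.lean` (which
explores the lowest open AND the lowest closed crossing avoiding the examined set at each stage):

* `TriQuad.numStages ω` — the number `t` of stages before no crossing of either colour avoids
  the examined set; `lt_numStages_iff`.
* `TriQuad.openStageCount ω` / `closedStageCount ω` — the numbers of stages at which an open
  (resp. closed) crossing avoids the examined set; `numStages_le_add` (`t ≤ #open + #closed`).
* `TriQuad.openStageCount_subset_disjointOccurrencePow` — **`j` open stages give `j` pairwise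
  disjoint open crossings** (the lowest open crossings of these stages avoid all earlier examined
  sets, which contain the earlier crossings), i.e. `{#open ≥ j} ⊆ LR □ ⋯ □ LR`; hence, by the
  iterated BK inequality (`real_disjointOccurrencePow_le_pow`),
  `P_p(#open stages ≥ j) ≤ P_p(open L–R crossing)^j` (`real_openStageCount_ge_le`), the closed
  count likewise at the dual parameter (`real_closedStageCount_ge_le`), and
  `P_p(t ≥ 2j) ≤ P_p(LR)^j + P_{1-p}(LR)^j` (`real_numStages_ge_le`).

## References

* P. Nolin, Near-critical percolation in two dimensions, *Electron. J. Probab.* 13 (2008), §4.4,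
  proof of Lemma 15 [arXiv 0711.4948: Lemma 14] [Nolin2008].
* J. van den Berg, H. Kesten, Inequalities with applications to percolation and reliability,
  *J. Appl. Probab.* 22 (1985) 556–569 [vandenBergKestenJAP1985].

## Mathlib / tree

Tree: `TriQuad.stages`, `TriQuad.not_LRPath_stages`, `TriQuad.stages_mono`, `TriQuad.stages_compl`
(`TriQuadStages.lean`), `TriQuad.LRPath`, `TriQuad.exists_lr_subset_explored`,
`TriQuad.LRPath_congr` (`TriLowestCrossingSwitch.lean`), `disjointOccurrencePow`,
`mem_disjointOccurrencePow_of_pairwise_disjoint` (`DisjointOccurrencePow.lean`),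
`real_disjointOccurrencePow_le_pow` (`TriAnnulusArms.lean`), `sitePercolation_real_preimage_compl`.
-/

noncomputable section

open MeasureTheory Set

namespace Literature.Probability.Percolation

open LatticeModels

namespace TriQuad

variable {Q : TriQuad}

/-! ### The number of stages -/

variable (Q) in
/-- Termination predicate of the construction at stage `t`: no crossing of either colour avoids
the examined set `N_t`. [folklore] -/
def Stopped (ω : Set (Site 2)) (t : ℕ) : Prop :=
  ¬ Q.LRPath (ω \ ↑(Q.stages ω t)) ∧ ¬ Q.LRPath (ωᶜ \ ↑(Q.stages ω t))

/-- The construction stops eventually. [folklore] -/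
theorem exists_stopped (ω : Set (Site 2)) : ∃ t, Q.Stopped ω t := by
  obtain ⟨t, -, h⟩ := not_LRPath_stages (Q := Q) ω
  exact ⟨t, h⟩

open Classical in
variable (Q) in
/-- **The number of stages** `t(ω)`: the first stage at which no crossing of either colour avoids
the examined set (Nolin: "The process stops after `t` steps"). [cite: Nolin2008, §4.4, proof of Lemma 15 (arXiv 0711.4948: Lemma 14)] -/
def numStages (ω : Set (Site 2)) : ℕ := Nat.find (exists_stopped (Q := Q) ω)

/-- At the last stage the construction has stopped. [folklore] -/
theorem stopped_numStages (ω : Set (Site 2)) : Q.Stopped ω (Q.numStages ω) := by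
  classical
  exact Nat.find_spec (exists_stopped (Q := Q) ω)

/-- Before the last stage some crossing of either colour avoids the examined set. [folklore] -/
theorem lrPath_or_of_lt_numStages {ω : Set (Site 2)} {u : ℕ} (hu : u < Q.numStages ω) :
    Q.LRPath (ω \ ↑(Q.stages ω u)) ∨ Q.LRPath (ωᶜ \ ↑(Q.stages ω u)) := by
  classical
  have := Nat.find_min (exists_stopped (Q := Q) ω) hu
  unfold Stopped at this
  tauto

/-- **A stage at which a crossing of either colour avoids the examined set comes before the
end of the construction.** [folklore] -/
theorem lt_numStages_of_lrPath {ω : Set (Site 2)} {u : ℕ}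
    (h : Q.LRPath (ω \ ↑(Q.stages ω u)) ∨ Q.LRPath (ωᶜ \ ↑(Q.stages ω u))) : u < Q.numStages ω := by
  by_contra hle
  push Not at hle
  have hmono : (↑(Q.stages ω (Q.numStages ω)) : Set (Site 2)) ⊆ ↑(Q.stages ω u) :=
    Finset.coe_subset.2 (stages_mono ω hle)
  obtain ⟨h1, h2⟩ := stopped_numStages (Q := Q) ω
  rcases h with h | h
  · exact h1 (h.mono fun z hz => ⟨hz.2.1, fun hz' => hz.2.2 (hmono hz')⟩)
  · exact h2 (h.mono fun z hz => ⟨hz.2.1, fun hz' => hz.2.2 (hmono hz')⟩)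

/-- The number of stages is at most `|U| + 1`. [folklore] -/
theorem numStages_le (ω : Set (Site 2)) : Q.numStages ω ≤ Q.U.card + 1 := by
  classical
  obtain ⟨t, ht, h⟩ := not_LRPath_stages (Q := Q) ω
  exact (Nat.find_min' _ h).trans ht

/-- The number of stages is symmetric under colour exchange. [folklore] -/
theorem numStages_compl (ω : Set (Site 2)) : Q.numStages ωᶜ = Q.numStages ω := by
  classical
  unfold numStages
  congr 1
  ext t
  simp only [Stopped, stages_compl, compl_compl]
  tauto

open Classical in
variable (Q) in
/-- **The number of open stages**: stages `u < t` at which an open crossing avoids `N_u`. [cite: Nolin2008, §4.4, proof of Lemma 15 (arXiv 0711.4948: Lemma 14)] -/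
def openStageCount (ω : Set (Site 2)) : ℕ :=
  ((Finset.range (Q.numStages ω)).filter fun u => Q.LRPath (ω \ ↑(Q.stages ω u))).card

open Classical in
variable (Q) in
/-- **The number of closed stages**: stages `u < t` at which a closed crossing avoids `N_u`. [cite: Nolin2008, §4.4, proof of Lemma 15 (arXiv 0711.4948: Lemma 14)] -/
def closedStageCount (ω : Set (Site 2)) : ℕ :=
  ((Finset.range (Q.numStages ω)).filter fun u => Q.LRPath (ωᶜ \ ↑(Q.stages ω u))).card

/-- Closed stages of `ω` are open stages of `ωᶜ`. [folklore] -/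
theorem closedStageCount_eq (ω : Set (Site 2)) : Q.closedStageCount ω = Q.openStageCount ωᶜ := by
  classical
  unfold closedStageCount openStageCount
  rw [numStages_compl]
  congr 1
  ext u
  simp only [Finset.mem_filter, stages_compl]

/-- **Every stage is an open stage or a closed stage**: `t ≤ #open + #closed`. [folklore] -/
theorem numStages_le_add (ω : Set (Site 2)) :
    Q.numStages ω ≤ Q.openStageCount ω + Q.closedStageCount ω := by
  classical
  unfold openStageCount closedStageCount
  calc Q.numStages ω = (Finset.range (Q.numStages ω)).card := (Finset.card_range _).symm
    _ ≤ (((Finset.range (Q.numStages ω)).filter fun u => Q.LRPath (ω \ ↑(Q.stages ω u))) ∪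
          ((Finset.range (Q.numStages ω)).filter fun u => Q.LRPath (ωᶜ \ ↑(Q.stages ω u)))).card := by
        refine Finset.card_le_card fun u hu => ?_
        rw [Finset.mem_union, Finset.mem_filter, Finset.mem_filter]
        rcases lrPath_or_of_lt_numStages (Finset.mem_range.1 hu) with h | h
        · exact Or.inl ⟨hu, h⟩
        · exact Or.inr ⟨hu, h⟩
    _ ≤ _ := Finset.card_union_le _ _

/-! ### Open stages give disjoint open crossings -/

/-- The open crossing event of the quad is increasing. [folklore] -/
theorem isUpperSet_lrPath : IsUpperSet {ξ : Set (Site 2) | Q.LRPath ξ} :=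
  fun _ _ hle h => LRPath.mono (fun _ hz => hle hz.2) h

/-- **`j` open stages give `j` pairwise disjoint open crossings**: at an open stage `u` the lowest
open crossing avoiding `N_u` lies in `N_{u+1} \ N_u`, and the sets `N_{u+1} \ N_u` of distinct
stages are disjoint; hence `{#open stages ≥ j} ⊆ LR □ ⋯ □ LR`
(`mem_disjointOccurrencePow_of_pairwise_disjoint`). [cite: Nolin2008, §4.4, proof of Lemma 15 ("there cannot be too many disjoint crossings"; arXiv 0711.4948: Lemma 14)] -/
theorem mem_disjointOccurrencePow_of_le_openStageCount {ω : Set (Site 2)} {j : ℕ}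
    (hj : j ≤ Q.openStageCount ω) : ω ∈ disjointOccurrencePow {ξ | Q.LRPath ξ} j := by
  classical
  set G := (Finset.range (Q.numStages ω)).filter fun u => Q.LRPath (ω \ ↑(Q.stages ω u)) with hG
  -- the open witnesses: the open sites of `N_{u+1} \ N_u`
  set K : ℕ → Set (Site 2) := fun u => (ω ∩ ↑(Q.stages ω (u + 1))) \ ↑(Q.stages ω u) with hK
  have hKω : ∀ u, K u ⊆ ω := fun u z hz => hz.1.1
  have hKA : ∀ u ∈ G, K u ∈ {ξ : Set (Site 2) | Q.LRPath ξ} := by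
    intro u hu
    rw [hG, Finset.mem_filter] at hu
    obtain ⟨x, hx, y, hy, hp⟩ := exists_lr_subset_explored hu.2
    refine ⟨x, hx, y, hy, hp.mono fun z hz => ⟨hz.1, ⟨hz.2.1.1, ?_⟩, hz.2.1.2⟩⟩
    rw [stages_succ]
    exact Finset.mem_coe.2 (mem_stage.2 (Or.inr (Or.inl (Finset.mem_coe.1 hz.2.2))))
  have hKdisj : ∀ u u' : ℕ, u < u' → Disjoint (K u) (K u') := by
    intro u u' huu'
    refine Set.disjoint_left.2 fun z hz hz' => hz'.2 ?_
    exact Finset.mem_coe.2 (stages_mono ω (Nat.succ_le_of_lt huu') (Finset.mem_coe.1 hz.1.2))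
  -- `j` distinct open stages
  obtain ⟨G', hG'G, hcard⟩ := Finset.exists_subset_card_eq hj
  set e : Fin j → ℕ := fun i => ((G'.equivFin.symm (Fin.cast hcard.symm i) : G') : ℕ) with he
  have he_mem : ∀ i, e i ∈ G := fun i => hG'G (G'.equivFin.symm (Fin.cast hcard.symm i)).2
  have he_inj : Function.Injective e := by
    intro i i' h
    have h1 := G'.equivFin.symm.injective (Subtype.ext h)
    exact Fin.ext (by simpa [Fin.cast] using congrArg Fin.val h1)
  refine mem_disjointOccurrencePow_of_pairwise_disjoint isUpperSet_lrPath
    (fun i => K (e i)) (fun i => hKω _) (fun i => hKA _ (he_mem i)) fun i i' hii' => ?_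
  rcases lt_or_gt_of_ne (fun h => hii' (he_inj h)) with h | h
  · exact hKdisj _ _ h
  · exact (hKdisj _ _ h).symm


/-- The open crossing event of the quad is determined by the sites of the domain. [folklore] -/
theorem determinedBy_lrPath : DeterminedBy {ξ : Set (Site 2) | Q.LRPath ξ} ↑Q.U := by
  rw [determinedBy_iff]
  intro ξ ξ' h
  refine LRPath_congr fun z hz => ?_
  have := congrArg (fun S : Set (Site 2) => z ∈ S) h
  simpa [hz] using this

/-! ### The tail bounds -/

/-- **BK tail of the number of open stages**: `P_p(#open stages ≥ j) ≤ P_p(open L–R crossing)^j`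
(iterated van den Berg–Kesten inequality). [cite: Nolin2008, §4.4, proof of Lemma 15 ("(1-δ')^h"; arXiv 0711.4948: Lemma 14)] [cite: vandenBergKestenJAP1985, Theorem (BK inequality)] -/
theorem real_openStageCount_ge_le (p : unitInterval) (j : ℕ) :
    (triSitePercolation p).real {ω | j ≤ Q.openStageCount ω} ≤
      ((triSitePercolation p).real {ξ | Q.LRPath ξ}) ^ j := by
  unfold triSitePercolation
  calc (sitePercolation (Site 2) p).real {ω | j ≤ Q.openStageCount ω}
      ≤ (sitePercolation (Site 2) p).real (disjointOccurrencePow {ξ | Q.LRPath ξ} j) :=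
        measureReal_mono (fun ω hω => mem_disjointOccurrencePow_of_le_openStageCount hω) (measure_ne_top _ _)
    _ ≤ _ := real_disjointOccurrencePow_le_pow p determinedBy_lrPath isUpperSet_lrPath j

/-- **BK tail of the number of closed stages**, at the dual parameter:
`P_p(#closed stages ≥ j) ≤ P_{1-p}(open L–R crossing)^j`. [cite: Nolin2008, §4.4, proof of Lemma 15 (arXiv 0711.4948: Lemma 14)] -/
theorem real_closedStageCount_ge_le (p : unitInterval) (j : ℕ) :
    (triSitePercolation p).real {ω | j ≤ Q.closedStageCount ω} ≤
      ((triSitePercolation (unitInterval.symm p)).real {ξ | Q.LRPath ξ}) ^ j := by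
  have hset : {ω : Set (Site 2) | j ≤ Q.closedStageCount ω} = compl ⁻¹' {ω | j ≤ Q.openStageCount ω} := by
    ext ω; simp only [mem_setOf_eq, mem_preimage, closedStageCount_eq]
  rw [hset]
  unfold triSitePercolation
  rw [sitePercolation_real_preimage_compl]
  exact real_openStageCount_ge_le (unitInterval.symm p) j

/-- **The number of stages has an exponential tail**: `P_p(t ≥ 2j) ≤ P_p(LR)^j + P_{1-p}(LR)^j`
(Nolin: "`P(t ≥ T) ≤ (1-δ')^T`"). [cite: Nolin2008, §4.4, proof of Lemma 15 (arXiv 0711.4948: Lemma 14)] -/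
theorem real_numStages_ge_le (p : unitInterval) (j : ℕ) :
    (triSitePercolation p).real {ω | 2 * j ≤ Q.numStages ω} ≤
      ((triSitePercolation p).real {ξ | Q.LRPath ξ}) ^ j +
        ((triSitePercolation (unitInterval.symm p)).real {ξ | Q.LRPath ξ}) ^ j := by
  have hsub : {ω : Set (Site 2) | 2 * j ≤ Q.numStages ω} ⊆
      {ω | j ≤ Q.openStageCount ω} ∪ {ω | j ≤ Q.closedStageCount ω} := by
    intro ω hω
    have := numStages_le_add (Q := Q) ω
    simp only [mem_union, mem_setOf_eq] at hω ⊢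
    omega
  calc (triSitePercolation p).real {ω | 2 * j ≤ Q.numStages ω}
      ≤ (triSitePercolation p).real ({ω | j ≤ Q.openStageCount ω} ∪ {ω | j ≤ Q.closedStageCount ω}) :=
        measureReal_mono hsub (measure_ne_top _ _)
    _ ≤ (triSitePercolation p).real {ω | j ≤ Q.openStageCount ω} +
          (triSitePercolation p).real {ω | j ≤ Q.closedStageCount ω} := measureReal_union_le _ _
    _ ≤ _ := add_le_add (real_openStageCount_ge_le p j) (real_closedStageCount_ge_le p j)

end TriQuad

end Literature.Probability.Percolation
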